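import Summits.QuantumFields.YangMills.Theorems.CentreWallReflectionSlabReflection
import HarnessLib

/-!
# Slab decomposition of the four-torus Wilson weight, V: Polyakov holonomies, the bond dichotomy, wall and flip weights
# (crux `CentreWallReflection.WallReflection` ⟨stmt-QuantumFields-23707⟩, line `birth`, stub `stub_instantiate`; planner ym-idea-4 g18)

The `ν`-Polyakov holonomy of slice `t` of a glued configuration is read from the boundary data; the twist multiplies the slice-`0` holonomy by
`z`.  BOND DICHOTOMY (lattice Stokes, `LatticeStokes.sub_re_trace_map_rectangleHolonomy_le`): if the labels of two consecutive slices differ,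
one of the two holonomies is on the wall or one of the `n+1` ladder plaquettes costs `≥ δ/(n+1)²`; hence the INTEGRATED FLIP BOUND
`∫𝟙[flip] e^{−βS} ≤ Σ_{t<m}(N_t + N_{t+1}) + m(n+1) e^{−βδ/(n+1)²}` (pinned plaquettes are absolutely small).
HONEST FRAMING: lattice bookkeeping toward ONE crux of a draft route (fixed torus, finite lattice); nothing here proves the route's target
`MarginalTwistOnset.FixedTorusCriterionFailure`, any continuum statement, or the Yang–Mills mass gap.  THEOREMS ONLY (no `def`, no `sorry`),
standard axioms.  References: [cite: OsterwalderSeiler1978, §2]; [cite: tHooft1979]; E. T. Tomboulis, L. G. Yaffe, CMP 100 (1985) 313;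
[cite: Luscher1983, §2].
-/

set_option autoImplicit false

noncomputable section

open scoped BigOperators
open MeasureTheory Literature.MathematicalPhysics.QuantumFieldTheory

namespace Summit.QuantumFields.YangMills.Theorems.CentreWallReflection.Slab

open MeasureTheory
open Summit.QuantumFields.YangMills.Theorems.FemtoCurvatureTwoPointC (LatticeStokes.sub_re_trace_map_rectangleHolonomy_le)

/-! ## §13 Polyakov holonomies: base sites, gluing, twist -/

section Polyakov

variable {n : ℕ} {G : Type*} [Group G] {N : ℕ} (ρ : G →* Matrix (Fin N) (Fin N) ℂ) (μ ν : Fin 4)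

omit [Group G] in
/-- `baseSite_apply_self` (slab bookkeeping, see the module docstring). -/
theorem baseSite_apply_self (t : ℕ) : baseSite (n := n) μ t μ = (t : ZMod (n + 1)) := by simp [baseSite]

omit [Group G] in
/-- `baseSite_apply_of_ne` (slab bookkeeping, see the module docstring). -/
theorem baseSite_apply_of_ne (t : ℕ) {i : Fin 4} (hi : i ≠ μ) : baseSite (n := n) μ t i = 0 := by simp [baseSite, hi]

omit [Group G] in
/-- `baseSite_zero` (slab bookkeeping, see the module docstring). -/
theorem baseSite_zero : baseSite (n := n) μ 0 = 0 := by
  funext i; by_cases hi : i = μ <;> simp [baseSite, hi]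

omit [Group G] in
/-- `baseSite_add_single` (slab bookkeeping, see the module docstring). -/
theorem baseSite_add_single (t : ℕ) : baseSite (n := n) μ t + Pi.single μ 1 = baseSite μ (t + 1) := by
  funext i; by_cases hi : i = μ
  · subst hi; simp [baseSite, Nat.cast_succ]
  · simp [baseSite, hi]

variable {μ ν}

/-- `lineHolonomy U k m y` only reads the links `(y + s e_k, k)`, `s < m`. -/
theorem lineHolonomy_congr' {U V : GaugeConfig 4 (n + 1) G} (k : Fin 4) :
    ∀ (m : ℕ) (y : Site 4 (n + 1)),
      (∀ s : ℕ, s < m → U (y + Pi.single k (s : ZMod (n + 1)), k) = V (y + Pi.single k (s : ZMod (n + 1)), k)) →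
      lineHolonomy U k m y = lineHolonomy V k m y
  | 0, y, _ => by simp [lineHolonomy]
  | m + 1, y, h => by
    rw [lineHolonomy, lineHolonomy]
    have h0 := h 0 (Nat.succ_pos m)
    simp only [Nat.cast_zero, Pi.single_zero, add_zero] at h0
    rw [h0, lineHolonomy_congr' k m (y.shift k) fun s hs => ?_]
    have e : y.shift k + Pi.single k (s : ZMod (n + 1)) = y + Pi.single k (((s + 1 : ℕ) : ZMod (n + 1))) := by
      simp only [Site.shift, add_assoc, ← Pi.single_add, Nat.cast_succ, add_comm (1 : ZMod (n + 1))]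
    rw [e]
    exact h (s + 1) (by omega)

/-- The Polyakov holonomy of slice `t` reads only `ν`-links of level `t`. -/
theorem polyakov_congr (hμν : μ ≠ ν) (t : ℕ) {U V : GaugeConfig 4 (n + 1) G}
    (h : ∀ x : Site 4 (n + 1), x μ = (t : ZMod (n + 1)) → U (x, ν) = V (x, ν)) : polyakov μ ν t U = polyakov μ ν t V := by
  unfold polyakov
  refine lineHolonomy_congr' ν (n + 1) _ fun s _ => h _ ?_
  rw [Pi.add_apply, baseSite_apply_self, Pi.single_eq_of_ne hμν, add_zero]

/-- On a glued configuration, the slice-`0` Polyakov holonomy is that of `X`. -/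
theorem polyakov_zero_glue (hμν : μ ≠ ν) (j : ℕ) (U X A : GaugeConfig 4 (n + 1) G) :
    polyakov μ ν 0 (glue μ j U X A) = polyakov μ ν 0 X :=
  polyakov_congr hμν 0 fun x hx => glue_apply_slice0 μ j U X A hμν.symm (by rw [Nat.cast_zero] at hx; exact hx)

/-- On a glued configuration, the slice-`j` Polyakov holonomy is the slice-`0` Polyakov holonomy of `A`. -/
theorem polyakov_glue_sliceJ (hμν : μ ≠ ν) {j : ℕ} (hj1 : 1 ≤ j) (hjn : j ≤ n) (U X A : GaugeConfig 4 (n + 1) G) :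
    polyakov μ ν j (glue μ j U X A) = polyakov μ ν 0 A := by
  have hj0 := natCast_ne_zero_of_le (n := n) j hj1 hjn
  unfold polyakov
  -- compare link by link along the two lines
  have key : ∀ s : ℕ, glue μ j U X A (baseSite μ j + Pi.single ν (s : ZMod (n + 1)), ν) =
      A (baseSite μ 0 + Pi.single ν (s : ZMod (n + 1)), ν) := by
    intro s
    have hlev : ((baseSite μ j + Pi.single ν (s : ZMod (n + 1)) : Site 4 (n + 1)) μ) = (j : ZMod (n + 1)) := by
      rw [Pi.add_apply, baseSite_apply_self, Pi.single_eq_of_ne hμν, add_zero]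
    rw [glue_apply_sliceJ μ j U X A hμν.symm hj0 hlev]
    congr 2
    funext i; by_cases hi : i = μ
    · subst hi; simp [baseSite, Pi.single_eq_of_ne hμν]
    · simp [baseSite, hi]
  -- both sides are line holonomies reading equal links
  suffices h : ∀ (m : ℕ) (s₀ : ℕ), lineHolonomy (glue μ j U X A) ν m (baseSite μ j + Pi.single ν (s₀ : ZMod (n + 1))) =
      lineHolonomy A ν m (baseSite μ 0 + Pi.single ν (s₀ : ZMod (n + 1))) by
    simpa using h (n + 1) 0
  intro m
  induction m with
  | zero => intro s₀; simp [lineHolonomy]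
  | succ m ih =>
    intro s₀
    simp only [lineHolonomy]
    rw [key s₀]
    have e1 : (baseSite (n := n) μ j + Pi.single ν (s₀ : ZMod (n + 1))).shift ν = baseSite μ j + Pi.single ν ((s₀ + 1 : ℕ) : ZMod (n + 1)) := by
      simp only [Site.shift, add_assoc, ← Pi.single_add, Nat.cast_succ]
    have e2 : (baseSite (n := n) μ 0 + Pi.single ν (s₀ : ZMod (n + 1))).shift ν = baseSite μ 0 + Pi.single ν ((s₀ + 1 : ℕ) : ZMod (n + 1)) := by
      simp only [Site.shift, add_assoc, ← Pi.single_add, Nat.cast_succ]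
    rw [e1, e2, ih]

/-- **The twist multiplies the slice-`0` Polyakov holonomy by `z`.** -/
theorem polyakov_zero_twistMap (z : G) (X : GaugeConfig 4 (n + 1) G) :
    polyakov μ ν 0 (twistMap μ ν z X) = z * polyakov μ ν 0 X := by
  unfold polyakov
  rw [baseSite_zero]
  show lineHolonomy (twistMap μ ν z X) ν (n + 1) 0 = z * lineHolonomy X ν (n + 1) 0
  rw [lineHolonomy, lineHolonomy, twistMap_apply]
  have h0 : ((0 : Site 4 (n + 1)), ν).2 = ν ∧ ((0 : Site 4 (n + 1)), ν).1 μ = 0 ∧ ((0 : Site 4 (n + 1)), ν).1 ν = 0 := ⟨rfl, rfl, rfl⟩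
  rw [if_pos h0, mul_assoc]
  congr 1
  refine congrArg _ (lineHolonomy_congr' ν n _ fun s hs => ?_)
  rw [twistMap_apply]
  have hne : (((0 : Site 4 (n + 1)).shift ν + Pi.single ν (s : ZMod (n + 1)) : Site 4 (n + 1)) ν) ≠ 0 := by
    simp only [Site.shift, Pi.add_apply, Pi.single_eq_same, zero_add]
    have e : (1 : ZMod (n + 1)) + (s : ZMod (n + 1)) = ((1 + s : ℕ) : ZMod (n + 1)) := by push_cast; rfl
    rw [e, Ne, ZMod.natCast_eq_zero_iff]
    intro h; have := Nat.le_of_dvd (by omega) h; omega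
  rw [if_neg (fun h => hne h.2.2), one_mul]

/-! ## §14 The bond dichotomy (lattice Stokes) -/

/-- The thin ladder: the based `1 × (n+1)` rectangle in the `(μ, ν)` plane is `u P_{t+1} u⁻¹ P_t⁻¹`. -/
theorem rectangleHolonomy_ladder (t : ℕ) (W : GaugeConfig 4 (n + 1) G) :
    rectangleHolonomy W (baseSite μ t) μ ν 1 (n + 1) =
      W (baseSite μ t, μ) * polyakov μ ν (t + 1) W * (W (baseSite μ t, μ))⁻¹ * (polyakov μ ν t W)⁻¹ := by
  simp only [rectangleHolonomy, polyakov, lineHolonomy, mul_one, Nat.cast_one, ZMod.natCast_self, Pi.single_zero, add_zero,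
    baseSite_add_single]

/-- **Bond dichotomy.** If the labels of two consecutive slices differ, then one of the two Polyakov holonomies is on the wall or one of
the `n + 1` ladder plaquettes between the slices has cost `≥ δ/(n+1)²`. -/
theorem bond_dichotomy (hU : ∀ g, ρ g ∈ Matrix.unitaryGroup (Fin N) ℂ) {O : G → ℕ} {Wset : Set G} {δ : ℝ}
    (hOc : ∀ g h : G, O (h * g * h⁻¹) = O g) (hWc : ∀ g h : G, h * g * h⁻¹ ∈ Wset ↔ g ∈ Wset)
    (hloc : ∀ g g' : G, (N : ℝ) - (ρ (g⁻¹ * g')).trace.re < δ → g ∉ Wset → g' ∉ Wset → O g = O g')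
    (t : ℕ) (W : GaugeConfig 4 (n + 1) G) (hne : O (polyakov μ ν (t + 1) W) ≠ O (polyakov μ ν t W)) :
    polyakov μ ν t W ∈ Wset ∨ polyakov μ ν (t + 1) W ∈ Wset ∨
      ∃ s ∈ Finset.range (n + 1), δ / (((n + 1 : ℕ) : ℝ) ^ 2) ≤
        (N : ℝ) - (ρ (plaquetteHolonomy W (baseSite μ t + Pi.single ν (s : ZMod (n + 1))) μ ν)).trace.re := by
  by_cases h0 : polyakov μ ν t W ∈ Wset
  · exact Or.inl h0
  by_cases h1 : polyakov μ ν (t + 1) W ∈ Wset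
  · exact Or.inr (Or.inl h1)
  refine Or.inr (Or.inr ?_)
  -- Stokes bound on the ladder
  have hS0 := LatticeStokes.sub_re_trace_map_rectangleHolonomy_le ρ hU W μ ν 1 (n + 1) (baseSite μ t)
  have hS : (N : ℝ) - (ρ (W (baseSite μ t, μ) * polyakov μ ν (t + 1) W * (W (baseSite μ t, μ))⁻¹ * (polyakov μ ν t W)⁻¹)).trace.re ≤
      ((n + 1 : ℕ) : ℝ) * ∑ s ∈ Finset.range (n + 1),
        ((N : ℝ) - (ρ (plaquetteHolonomy W (baseSite μ t + Pi.single ν (s : ZMod (n + 1))) μ ν)).trace.re) := by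
    rw [rectangleHolonomy_ladder (μ := μ) (ν := ν) t W] at hS0
    simpa only [Finset.sum_range_one, Nat.cast_zero, Pi.single_zero, add_zero, one_mul] using hS0
  -- local constancy between `P_t` and the transported `u P_{t+1} u⁻¹` forces the ladder cost to be `≥ δ`
  have htr : (ρ ((polyakov μ ν t W)⁻¹ * (W (baseSite μ t, μ) * polyakov μ ν (t + 1) W * (W (baseSite μ t, μ))⁻¹))).trace.re =
      (ρ (W (baseSite μ t, μ) * polyakov μ ν (t + 1) W * (W (baseSite μ t, μ))⁻¹ * (polyakov μ ν t W)⁻¹)).trace.re := by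
    rw [map_mul ρ (polyakov μ ν t W)⁻¹, Matrix.trace_mul_comm, ← map_mul]
  have h1' : W (baseSite μ t, μ) * polyakov μ ν (t + 1) W * (W (baseSite μ t, μ))⁻¹ ∉ Wset := fun h => h1 ((hWc _ _).mp h)
  have hδ : δ ≤ (N : ℝ) - (ρ (W (baseSite μ t, μ) * polyakov μ ν (t + 1) W * (W (baseSite μ t, μ))⁻¹ * (polyakov μ ν t W)⁻¹)).trace.re := by
    by_contra hlt
    have hclose : (N : ℝ) - (ρ ((polyakov μ ν t W)⁻¹ *
        (W (baseSite μ t, μ) * polyakov μ ν (t + 1) W * (W (baseSite μ t, μ))⁻¹))).trace.re < δ := by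
      rw [htr]; exact lt_of_not_ge hlt
    have := hloc _ _ hclose h0 h1'
    rw [hOc] at this
    exact hne this.symm
  -- hence some ladder plaquette has cost `≥ δ/(n+1)²`
  have hpos : (0 : ℝ) < ((n + 1 : ℕ) : ℝ) := by positivity
  have hsum : ∑ _s ∈ Finset.range (n + 1), δ / (((n + 1 : ℕ) : ℝ) ^ 2) ≤
      ∑ s ∈ Finset.range (n + 1), ((N : ℝ) - (ρ (plaquetteHolonomy W (baseSite μ t + Pi.single ν (s : ZMod (n + 1))) μ ν)).trace.re) := by
    rw [Finset.sum_const, Finset.card_range, nsmul_eq_mul]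
    have e : ((n + 1 : ℕ) : ℝ) * (δ / (((n + 1 : ℕ) : ℝ) ^ 2)) = δ / ((n + 1 : ℕ) : ℝ) := by field_simp
    rw [e, div_le_iff₀ hpos, mul_comm]
    exact hδ.trans hS
  exact Finset.exists_le_of_sum_le (Finset.nonempty_range_iff.mpr (Nat.succ_ne_zero n)) hsum

/-- Telescoping: if the labels of slices `0` and `m` differ, some consecutive pair differs. -/
theorem exists_bond_of_ne {O : G → ℕ} (m : ℕ) (W : GaugeConfig 4 (n + 1) G)
    (hne : O (polyakov μ ν m W) ≠ O (polyakov μ ν 0 W)) :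
    ∃ t ∈ Finset.range m, O (polyakov μ ν (t + 1) W) ≠ O (polyakov μ ν t W) := by
  by_contra h
  push Not at h
  apply hne
  induction m with
  | zero => rfl
  | succ m ih =>
    rw [h m (Finset.self_mem_range_succ m)]
    exact ih (fun h' => hne (by rw [← h m (Finset.self_mem_range_succ m)] at h'; exact h')) fun t ht => h t (Finset.mem_range.mpr (by
      have := Finset.mem_range.mp ht; omega))

end Polyakov

end Summit.QuantumFields.YangMills.Theorems.CentreWallReflection.Slab

end
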